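import Summits.QuantumFields.YangMills.Theorems.FlatTubeReductionBORateBricksD
import Summits.QuantumFields.YangMills.Theorems.FlatTubeReductionBORateBricks
import Summits.QuantumFields.YangMills.Theorems.FlatTubeReductionDressedSlowRate
import Summits.QuantumFields.YangMills.Theorems.FlatTubeReductionRecordAnalyticRate
import Summits.QuantumFields.YangMills.Theorems.FlatTubeReductionBOAssemblyFloorRate
import Summits.QuantumFields.YangMills.Theorems.FlatTubeReductionSoftTubeRate
import HarnessLib

/-!
# `BORateBricksD → RateTube.SoftTubeBORatePackageOn` and K1 ⇐ `BORateBricksD` for the record weight (`K = 43`): the rate-grade Born–Oppenheimer package ASSEMBLED from the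
# DRESSED brick list (no `W ≤ 1`) — g10 repair of `softTubeBORatePackageOn_of_rateBricks` (p652029) for `L ≥ 3`
# (route `FlatTubeReduction`, crux K1 `NearFlatRatioLaw` stmt-QuantumFields-24720; seat `ym-line-ftr-p1` g10; R2b1 RECORD rung — no summit statement is proved here)

* ★★★ `softTubeBORatePackageOn_of_rateBricksD : BORateBricksD L χ δ → RateTube.SoftTubeBORatePackageOn L χ {orbitDist < δ}` — p652029's assembly verbatim except for the SLOW
  clause, which now comes from `slow_rate_clause_of_dressed` (p656642) and the brick field `hDS` (the DRESSED one-site no-intruder, norm undressed) instead of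
  (`W ≤ 1` + the undressed `oneOrbitRate_one`); constant `C := max (max (48a_κ) (16a_b/θ₀)) (max (8|C_D|) (16·max C'' 1))`.
* ★★★★ `nearFlatRatioLaw_of_rateBricksD` / `femtoGapFixedLattice_of_rateBricksD` — K1 24720 and FCL 23943 from dressed rate bricks for the record weight `recordChi L (1/40) 43 M`
  (`M ≥ 2`), test support `{orbitDist < β^{−1/40}}`, every `L ≥ 2` (via `innerRateAt_of_ratePackage` p648741, `softTubeAdmissible_recordChi'` p653506, `nearFlatRatioLaw_of_innerRate`
  p626045 / `femtoGapFixedLatticeAt_of_valley_innerRate` + `femtoGapOneSite_proof`).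
WHY: `BORateBricks.hW1` is unsatisfiable for `L ≥ 3` (fibre-only zero-point energy has negative curvature at the vacuum: crux workfile `Lines/ratepack-dressing-g10.md`); the
package-level stub `stub_ratePackage` is unaffected; this file restores a NON-EMPTY typed route to it.
HONEST FRAMING: assembly algebra; the bricks (incl. `hDS`) are OPEN fixed-lattice semiclassics on `SU(2)^{3L³}` (pooled with RED lane A's C4-CORE and crux ONE's one-site
machinery); femto rung R2b1 (RECORD label); not infinite volume, not a gap, not Clay.  No defs, no named facts, no `sorry`.
-/

set_option autoImplicit false

noncomputable section

open MeasureTheory Filter Topology Real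
open scoped BigOperators
open Literature.MathematicalPhysics.QuantumFieldTheory
open Literature.MathematicalPhysics.QuantumLattice

namespace Summit.QuantumFields.YangMills.Theorems.FemtoTransferGap.RateTube

open Summit.QuantumFields.YangMills.Theorems.FemtoTransferGap
open Summit.QuantumFields.YangMills.Theorems.FemtoTransferGap.TwoLattice.Avg
open Summit.QuantumFields.YangMills.Theorems.FemtoTransferGap.TwoLattice.ConstTube
open Summit.QuantumFields.YangMills.Theorems.FemtoTransferGap.TwoLattice.Stiff (LinkSpace)
open Summit.QuantumFields.YangMills.Theorems.FemtoCutoffLadder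

variable {L : ℕ} [NeZero L]

/-! ## §1 ★★★ The assembly -/


set_option maxHeartbeats 400000 in
/-- ★★★ **THE RATE-GRADE BORN–OPPENHEIMER PACKAGE FROM THE DRESSED BRICK LIST**: `BORateBricksD L χ δ → RateTube.SoftTubeBORatePackageOn L χ (fun β ↦ {U | orbitDist U < δ β})`.
p652029 verbatim with `C := max (max (48a_κ) (16a_b/θ₀)) (max (8|C_D|) (16·max C'' 1))` (`κ ≤ y/48`, `b² ≤ yθ₀/16`, `e^{C_Dλ²} ≤ e^{y/8}`, `e^{−C''λ²} ≥ e^{−y/16}`), the DRESSED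
one-site no-intruder `hDS` (brick field) feeding `slow_rate_clause_of_dressed`, the dressed near-top amplitude `hTop`, and `crossBound_eventually_small_sq`.
[cite: Luscher1983, §3] [cite: SjostrandZworski2007, §2] -/
theorem softTubeBORatePackageOn_of_rateBricksD {χ : ℝ → GaugeConfig 3 L SU2 → ℝ} {δ : ℝ → ℝ} (K : BORateBricksD L χ δ) :
    SoftTubeBORatePackageOn L χ (fun β => {U | orbitDist U < δ β}) := by
  intro k
  obtain ⟨hθ0, hθ1⟩ := K.hθ₀
  have hL1 : (1 : ℝ) ≤ (L : ℝ) ^ 3 := one_le_pow₀ (by exact_mod_cast NeZero.one_le)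
  have hL3 : (0 : ℝ) < (L : ℝ) ^ 3 := by positivity
  -- crux ONE at `B = L³β`
  obtain ⟨C1, B0, hONE⟩ := oneSiteLevels_proof k
  -- the DRESSED one-site no-intruder at level `k` (brick field)
  obtain ⟨COS, hDSev⟩ := K.hDS k
  -- the rate constants of the bricks
  obtain ⟨aκ, hκev⟩ := K.hκ_small
  obtain ⟨ab, hbev⟩ := K.hb_small
  obtain ⟨C'', hTopev⟩ := K.hTop
  -- the constant `C`
  set C : ℝ := max (max (48 * aκ) (16 * ab / K.θ₀)) (max (8 * |COS|) (16 * max C'' 1)) with hCdef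
  have hC16 : 16 ≤ C := by
    have : (16 : ℝ) ≤ 16 * max C'' 1 := by nlinarith only [le_max_right C'' 1]
    exact this.trans ((le_max_right _ _).trans (le_max_right _ _))
  have hC0 : 0 ≤ C := by linarith only [hC16]
  have hCκ : 48 * aκ ≤ C := (le_max_left _ _).trans (le_max_left _ _)
  have hCb : 16 * ab / K.θ₀ ≤ C := (le_max_right _ _).trans (le_max_left _ _)
  have hCOS : 8 * |COS| ≤ C := (le_max_left _ _).trans (le_max_right _ _)
  have hC'' : 16 * C'' ≤ C := by
    have : 16 * C'' ≤ 16 * max C'' 1 := by nlinarith only [le_max_left C'' 1]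
    exact this.trans ((le_max_right _ _).trans (le_max_right _ _))
  refine ⟨C, K.θ₀, hC0, hθ0, hθ1, ?_⟩
  set τ : ℝ := min (1 / (2 * (|levelGap k| + |C1| + 2))) (1 / (C + 1)) with hτ
  have hτ0 : 0 < τ := by rw [hτ]; exact lt_min (by positivity) (by positivity)
  -- the eight copies (`λ_b²` version)
  obtain ⟨βc, hcross⟩ := crossBound_eventually_small_sq (L := L) (m := K.m) K.hm0 (ε := 1) one_pos
  -- collect everything eventually in `β`
  have hev : ∀ᶠ β : ℝ in atTop, ∃ σ b : ℝ, 0 < σ ∧ 0 ≤ b ∧ b ^ 2 ≤ C * bareLambda ((L : ℝ) ^ 3 * β) ^ 2 * K.θ₀ / 16 ∧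
      Real.exp (-(C * bareLambda ((L : ℝ) ^ 3 * β) ^ 2 / 4)) * (σ * levelValue su2Rep 1 ((L : ℝ) ^ 3 * β) 0) ≤ levelValue su2Rep L β 0 ∧
      ∀ f : Fin (k + 1) → (GaugeConfig 3 L SU2 → ℝ),
        (∀ i, Measurable (f i)) → (∀ i, ∃ C : ℝ, ∀ U, |f i U| ≤ C) → (∀ i U, f i U ≠ 0 → χ β U ≠ 0) → (∀ i U, f i U ≠ 0 → U ∈ {U : GaugeConfig 3 L SU2 | orbitDist U < δ β}) →
        (∀ a : Fin (k + 1) → ℝ, a ≠ 0 → 0 < tubeNormSq (softWeight (χ β)) (fun U => ∑ i, a i * f i U)) →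
          ∃ u v : Fin (k + 1) → (GaugeConfig 3 L SU2 → ℝ),
            (∀ a : Fin (k + 1) → ℝ,
              0 ≤ tubeNormSq (softWeight (χ β)) (fun U => ∑ i, a i * u i U) ∧
              0 ≤ tubeNormSq (softWeight (χ β)) (fun U => ∑ i, a i * v i U) ∧
              tubeNormSq (softWeight (χ β)) (fun U => ∑ i, a i * u i U) + tubeNormSq (softWeight (χ β)) (fun U => ∑ i, a i * v i U) ≤
                tubeNormSq (softWeight (χ β)) (fun U => ∑ i, a i * f i U) ∧
              tubeForm β (fun U => ∑ i, a i * v i U) ≤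
                (1 - K.θ₀) * (σ * levelValue su2Rep 1 ((L : ℝ) ^ 3 * β) 0) * tubeNormSq (softWeight (χ β)) (fun U => ∑ i, a i * v i U) ∧
              tubeForm β (fun U => ∑ i, a i * f i U) ≤
                tubeForm β (fun U => ∑ i, a i * u i U) +
                  2 * (b * (σ * levelValue su2Rep 1 ((L : ℝ) ^ 3 * β) 0)) *
                    Real.sqrt (tubeNormSq (softWeight (χ β)) (fun U => ∑ i, a i * u i U)) *
                    Real.sqrt (tubeNormSq (softWeight (χ β)) (fun U => ∑ i, a i * v i U)) +
                  tubeForm β (fun U => ∑ i, a i * v i U)) ∧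
            ∃ a : Fin (k + 1) → ℝ, a ≠ 0 ∧
              tubeForm β (fun U => ∑ i, a i * u i U) ≤
                Real.exp (C * bareLambda ((L : ℝ) ^ 3 * β) ^ 2 / 4) * (σ * levelValue su2Rep 1 ((L : ℝ) ^ 3 * β) k) *
                  tubeNormSq (softWeight (χ β)) (fun U => ∑ i, a i * u i U) := by
    filter_upwards [Filter.eventually_ge_atTop (max (max 1 B0) (max (max (1 : ℝ) 1) (max βc (2 / τ ^ 3)))),
      hκev, hbev, hTopev, K.htube, K.hshadow, K.hbo, K.hδ₂, K.hN, K.hT, K.hST, K.hOD, hDSev]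
      with β hβ hκs hbs hTop htube hshadow hbo hδ₂ hN hT hST hOD hDS
    -- numbers
    have hβ1 : 1 ≤ β := ((le_max_left _ _).trans (le_max_left _ _)).trans hβ
    have hβ0 : 0 < β := by linarith only [hβ1]
    have hβB0 : B0 ≤ β := ((le_max_right _ _).trans (le_max_left _ _)).trans hβ
    have hβc : βc ≤ β := (((le_max_left _ _).trans (le_max_right _ _)).trans (le_max_right _ _)).trans hβ
    have hβτ : 2 / τ ^ 3 ≤ β := (((le_max_right _ _).trans (le_max_right _ _)).trans (le_max_right _ _)).trans hβ
    set B : ℝ := (L : ℝ) ^ 3 * β with hBdef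
    have hBβ : β ≤ B := by rw [hBdef]; nlinarith only [hL1, hβ0]
    have hB0 : 0 < B := lt_of_lt_of_le hβ0 hBβ
    set lam : ℝ := bareLambda B with hlamdef
    have hlam0 : 0 < lam := bareLambda_pos' hB0
    have hlamτ : lam ≤ τ := bareLambda_cube_le (L := L) hτ0 hβτ
    have hτle : τ ≤ 1 / (2 * (|levelGap k| + |C1| + 2)) := min_le_left _ _
    have hτC : τ ≤ 1 / (C + 1) := min_le_right _ _
    obtain ⟨-, -, hy⟩ := smallness_of_le hlam0.le (hlamτ.trans hτle)
    have hlam1 : lam ≤ 1 := by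
      have h22 : τ ≤ 1 / (2 * 2) := hτle.trans (by
        apply div_le_div_of_nonneg_left (by norm_num) (by norm_num)
        nlinarith only [abs_nonneg (levelGap k), abs_nonneg C1])
      linarith only [hlamτ, h22]
    obtain ⟨hμ0, -, hμk⟩ := hONE B (hβB0.trans hBβ)
    set μ0 : ℝ := levelValue su2Rep 1 B 0 with hμ0def
    set μk : ℝ := levelValue su2Rep 1 B k with hμkdef
    have hμk' : Real.exp (-(levelGap k * lam + |C1| * lam ^ 2)) * μ0 ≤ μk := by
      refine le_trans (mul_le_mul_of_nonneg_right (Real.exp_le_exp.2 ?_) hμ0.le) hμk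
      have := mul_le_mul_of_nonneg_right (le_abs_self C1) (sq_nonneg lam)
      linarith only [this]
    have hμk2 : μ0 / 2 ≤ μk := half_le_of_exp_lower hy hμ0.le hμk'
    have hμkpos : 0 < μk := by linarith only [hμk2, hμ0]
    -- `y = C λ²`, `y ≤ 1`, `κ ≤ y/48`
    set y : ℝ := C * lam ^ 2 with hydef
    have hy0 : 0 ≤ y := by positivity
    have hlamC : lam ≤ 1 / (C + 1) := hlamτ.trans hτC
    have hy1 : y ≤ 1 := by
      rw [hydef]
      have h1 : C * lam ≤ 1 := by
        have h2 : C * lam ≤ C * (1 / (C + 1)) := mul_le_mul_of_nonneg_left hlamC hC0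
        have h3 : C * (1 / (C + 1)) ≤ 1 := by rw [mul_one_div, div_le_one (by linarith only [hC0])]; linarith only [hC0]
        exact h2.trans h3
      nlinarith only [h1, hlam0, hlam1, hC0]
    have hκ0 := K.hκ β
    have hκy : K.κ β ≤ y / 48 := by
      rw [hydef]
      have : aκ * lam ^ 2 ≤ C / 48 * lam ^ 2 := mul_le_mul_of_nonneg_right (by linarith only [hCκ]) (sq_nonneg lam)
      linarith only [hκs, this]
    have hκ1 : K.κ β < 1 := by linarith only [hκy, hy1]
    have hκ1' : K.κ β ≤ 1 := hκ1.le
    set w : GaugeConfig 3 L SU2 → ℝ := softWeight (χ β) with hwdef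
    obtain ⟨Cw, hCw⟩ := K.hwb β
    obtain ⟨hc0, hcχ⟩ := K.hc β
    -- fibre mass lower bound (for the projection)
    have hZ₀ : 0 < K.γ β * (1 - K.κ β) := mul_pos (K.hγ β) (by linarith)
    have hZ : ∀ u ∈ K.𝒰 β, K.γ β * (1 - K.κ β) ≤ fibreMassAd L w (K.Ω β) u := fun u hu => by
      have := (abs_le.mp (hN u hu)).1; linarith only [this]
    refine ⟨K.σ β, K.b β, K.hσ β, K.hb β, ?_, ?_, ?_⟩
    · -- b² ≤ C λ² θ / 16
      have h' : ab * lam ^ 2 ≤ C * lam ^ 2 * K.θ₀ / 16 := by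
        have h1 : ab ≤ C * K.θ₀ / 16 := by
          have := (div_le_iff₀ hθ0).mp (show 16 * ab / K.θ₀ ≤ C from hCb)
          linarith only [this]
        have := mul_le_mul_of_nonneg_right h1 (sq_nonneg lam)
        linarith only [this]
      exact hbs.trans h'
    · -- FLOOR
      obtain ⟨φ₀, hφm, ⟨C₀, hC₀⟩, hφg, hφs, hφpos, hφtop⟩ := hTop
      have hTφ := hT φ₀ hφm ⟨C₀, hC₀⟩ hφg hφs
      have hTlow : K.σ β * K.γ β * (1 - K.κ β) * qform su2Rep B (fun u => φ₀ u * K.W β u) (fun u => φ₀ u * K.W β u) -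
          K.κ β * K.σ β * K.γ β * μ0 * l2 φ₀ φ₀ ≤ tubeForm β (boFunAd L φ₀ (K.Ω β)) := by
        have := (abs_le.mp hTφ).1; linarith only [this]
      -- near-top with `ε'' := Cλ/16`: `e^{−(C/16)λ²} ≤ e^{−C''λ²}`
      have hφtop' : Real.exp (-(C * lam / 16 * bareLambda B)) * μ0 * l2 φ₀ φ₀ ≤ qform su2Rep B (fun u => φ₀ u * K.W β u) (fun u => φ₀ u * K.W β u) := by
        refine le_trans (mul_le_mul_of_nonneg_right (mul_le_mul_of_nonneg_right (Real.exp_le_exp.mpr ?_) hμ0.le) (l2_self_nonneg_lat _)) hφtop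
        rw [← hlamdef]
        have := mul_le_mul_of_nonneg_right hC'' (sq_nonneg lam)
        nlinarith only [this]
      have hcB : 28 * crossBound L β K.m ≤ C * lam / 16 * lam * levelValue su2Rep L β 0 := by
        have h1 := (hcross β hβc).trans (mul_le_mul_of_nonneg_left (levelValue_zero_ge_uniform hβ1) (by positivity))
        rw [← hBdef, ← hlamdef] at h1
        have h2 : 1 * lam ^ 2 * levelValue su2Rep L β 0 ≤ C * lam / 16 * lam * levelValue su2Rep L β 0 := by
          refine mul_le_mul_of_nonneg_right ?_ (levelValue_su2Rep_pos (L := L) hβ0 0).le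
          nlinarith only [hC16, sq_nonneg lam]
        exact h1.trans h2
      have harith : Real.exp (-(C * lam / 4 * lam)) * ((1 + C * lam / 16 * lam / 4) * (1 + K.κ β)) ≤
          (1 - K.κ β) * Real.exp (-(C * lam / 16 * lam)) - K.κ β := by
        have h := arith_floor hy0 hy1 hκ0 hκy
        have e1 : C * lam / 4 * lam = y / 4 := by rw [hydef]; ring
        have e2 : C * lam / 16 * lam / 4 = y / 64 := by rw [hydef]; ring
        have e3 : C * lam / 16 * lam = y / 16 := by rw [hydef]; ring
        rw [e1, e2, e3]; exact h
      have hfl := floor_rate_clause_of_bricks hβ0.le (K.hχm β) (K.hχ1 β) (K.hχ0 β) hc0 hcχ (K.hwm β) hCw (K.hΩm β) (K.hΩ1 β) K.hm hδ₂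
        (fun φ U hφ hU => hbo φ U hφ hU) (K.hσ β).le (K.hγ β) hκ0 hκ1' hN hφm hC₀ hφs hφpos hφtop' hTlow hcB (by positivity) hμ0.le harith
      have e : C * lam / 4 * lam = C * lam ^ 2 / 4 := by ring
      rw [e] at hfl
      exact hfl
    · -- the split for an admissible family
      intro f hfm hfb hfs hfS hGram
      set u : Fin (k + 1) → GaugeConfig 3 L SU2 → ℝ := fun i => boProjAd L w (K.Ω β) (K.𝒰 β) (f i) with hudef
      set v : Fin (k + 1) → GaugeConfig 3 L SU2 → ℝ := fun i => fun U => f i U - u i U with hvdef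
      choose Cf hCf using hfb
      -- combinations
      have hfam : ∀ a : Fin (k + 1) → ℝ, Measurable (fun U => ∑ i, a i * f i U) := fun a => Finset.measurable_sum _ fun i _ => (hfm i).const_mul _
      have hfab : ∀ a : Fin (k + 1) → ℝ, ∀ U, |∑ i, a i * f i U| ≤ ∑ i, |a i| * Cf i := fun a U =>
        (Finset.abs_sum_le_sum_abs _ _).trans (Finset.sum_le_sum fun i _ => by rw [abs_mul]; exact mul_le_mul_of_nonneg_left (hCf i U) (abs_nonneg _))
      have hfas : ∀ (a : Fin (k + 1) → ℝ) U, (∑ i, a i * f i U) ≠ 0 → χ β U ≠ 0 := fun a U hU => by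
        obtain ⟨i, hi⟩ := exists_ne_zero_of_combination_ne_zero hU; exact hfs i U hi
      have hfash : ∀ (a : Fin (k + 1) → ℝ) U, (∑ i, a i * f i U) ≠ 0 → slowMean L U ∈ K.𝒰 β := fun a U hU => by
        obtain ⟨i, hi⟩ := exists_ne_zero_of_combination_ne_zero hU; exact hshadow U (hfs i U hi) (hfS i U hi)
      have hua : ∀ a : Fin (k + 1) → ℝ, (fun U => ∑ i, a i * u i U) = boProjAd L w (K.Ω β) (K.𝒰 β) (fun U => ∑ i, a i * f i U) := fun a => by
        funext U; exact (boProjAd_sum (K.hwm β) hCw (K.hΩm β) (K.hΩ1 β) (K.𝒰 β) a hfm (fun i => ⟨Cf i, hCf i⟩) U).symm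
      have hva : ∀ a : Fin (k + 1) → ℝ, (fun U => ∑ i, a i * v i U) = fun U => (∑ i, a i * f i U) - boProjAd L w (K.Ω β) (K.𝒰 β) (fun U => ∑ i, a i * f i U) U := fun a => by
        funext U
        rw [← congrFun (hua a) U]
        simp only [hvdef, mul_sub, Finset.sum_sub_distrib]
      -- the projection of `f_a`: measurable, bounded
      have hPm : ∀ a : Fin (k + 1) → ℝ, Measurable (boProjAd L w (K.Ω β) (K.𝒰 β) (fun U => ∑ i, a i * f i U)) := fun a =>
        measurable_boFunAd L (measurable_boCoeffAd (K.hwm β) (K.hΩm β) (K.h𝒰m β) (hfam a)) (K.hΩm β)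
      have hPb : ∀ a : Fin (k + 1) → ℝ, ∀ U, |boProjAd L w (K.Ω β) (K.𝒰 β) (fun U => ∑ i, a i * f i U) U| ≤
          (∑ i, |a i| * Cf i) * 1 * Cw * (orthoTransverse L).real Set.univ / (K.γ β * (1 - K.κ β)) * 1 := fun a =>
        abs_boFunAd_le L (abs_boCoeffAd_le hCw (K.hΩ1 β) hZ₀ hZ (hfab a)) (K.hΩ1 β)
      have hrem := fun a : Fin (k + 1) → ℝ => remainder_propsAd (K.hwm β) hCw (K.hΩm β) (K.hΩ1 β) (K.h𝒰m β) hZ₀ hZ (fun φ U hφ hU => (hbo φ U hφ hU).1)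
        (hfam a) (hfab a) (hfas a) (hfash a)
      have hvm : ∀ a : Fin (k + 1) → ℝ, Measurable (fun U => (∑ i, a i * f i U) - boProjAd L w (K.Ω β) (K.𝒰 β) (fun U => ∑ i, a i * f i U) U) := fun a =>
        (hfam a).sub (hPm a)
      have hvb : ∀ a : Fin (k + 1) → ℝ, ∀ U, |(∑ i, a i * f i U) - boProjAd L w (K.Ω β) (K.𝒰 β) (fun U => ∑ i, a i * f i U) U| ≤
          (∑ i, |a i| * Cf i) + (∑ i, |a i| * Cf i) * 1 * Cw * (orthoTransverse L).real Set.univ / (K.γ β * (1 - K.κ β)) * 1 := fun a U =>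
        (abs_sub _ _).trans (add_le_add (hfab a U) (hPb a U))
      refine ⟨u, v, fun a => ⟨?_, ?_, ?_, ?_, ?_⟩, ?_⟩
      · exact integral_nonneg fun U => mul_nonneg (sq_nonneg _) (K.hw0 β U)
      · exact integral_nonneg fun U => mul_nonneg (sq_nonneg _) (K.hw0 β U)
      · -- MASS (exact)
        rw [hua a, hva a]
        exact le_of_eq (tubeNormSq_boProjAd_add (K.hwm β) hCw (K.hΩm β) (K.hΩ1 β) (K.h𝒰m β) hZ₀ hZ (hfam a) (hfab a))
      · -- STIFF
        rw [hva a]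
        exact hST _ (hvm a) ⟨_, hvb a⟩ (hrem a).1 (hrem a).2
      · -- OFFDIAG
        have hum' : Measurable (fun U => ∑ i, a i * u i U) := by rw [hua a]; exact hPm a
        have hub' : ∀ U, |∑ i, a i * u i U| ≤ (∑ i, |a i| * Cf i) * 1 * Cw * (orthoTransverse L).real Set.univ / (K.γ β * (1 - K.κ β)) * 1 := fun U => by
          have e := congrFun (hua a) U; rw [e]; exact hPb a U
        have hvm' : Measurable (fun U => ∑ i, a i * v i U) := by rw [hva a]; exact hvm a
        have hvb' : ∀ U, |∑ i, a i * v i U| ≤ (∑ i, |a i| * Cf i) + (∑ i, |a i| * Cf i) * 1 * Cw * (orthoTransverse L).real Set.univ / (K.γ β * (1 - K.κ β)) * 1 :=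
          fun U => by have e := congrFun (hva a) U; rw [e]; exact hvb a U
        have hvs' : ∀ U, (∑ i, a i * v i U) ≠ 0 → χ β U ≠ 0 := fun U hU => by
          have e := congrFun (hva a) U; rw [e] at hU; exact (hrem a).1 U hU
        have hvo' : ∀ u', fibreInnerAd L w (K.Ω β) (fun U => ∑ i, a i * v i U) u' = 0 := fun u' => by rw [hva a]; exact (hrem a).2 u'
        have hsplit : (fun U => ∑ i, a i * f i U) = fun U => (∑ i, a i * u i U) + (∑ i, a i * v i U) := by
          funext U; rw [← Finset.sum_add_distrib]; exact Finset.sum_congr rfl fun i _ => by simp only [hvdef]; ring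
        rw [hsplit, tubeForm_add β hum' hub' hvm' hvb']
        have hcs : ∀ u', boCoeffAd L w (K.Ω β) (K.𝒰 β) (fun U => ∑ i, a i * f i U) u' ≠ 0 → u' ∈ K.𝒰 β := fun u' hu => by
          by_contra hnu; exact hu (show boCoeffAd L w (K.Ω β) (K.𝒰 β) _ u' = 0 by unfold boCoeffAd; rw [Set.indicator_of_notMem hnu])
        have e1 : boFunAd L (boCoeffAd L w (K.Ω β) (K.𝒰 β) (fun U => ∑ i, a i * f i U)) (K.Ω β) = fun U => ∑ i, a i * u i U := (hua a).symm
        obtain ⟨h1, h2⟩ := hOD (boCoeffAd L w (K.Ω β) (K.𝒰 β) (fun U => ∑ i, a i * f i U)) (fun U => ∑ i, a i * v i U)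
          (measurable_boCoeffAd (K.hwm β) (K.hΩm β) (K.h𝒰m β) (hfam a)) ⟨_, abs_boCoeffAd_le hCw (K.hΩ1 β) hZ₀ hZ (hfab a)⟩ hcs hvm' ⟨_, hvb'⟩ hvs' hvo'
        rw [e1] at h1 h2
        have h1' := (abs_le.mp h1).2
        have h2' := (abs_le.mp h2).2
        linarith only [h1', h2']
      · -- SLOW (dressed one-site form; one-site inner RATE)
        have hTup : ∀ φ : GaugeConfig 3 1 SU2 → ℝ, Measurable φ → (∃ C : ℝ, ∀ u, |φ u| ≤ C) →
            (∀ (g : Site 3 1 → SU2) (u : GaugeConfig 3 1 SU2), φ (gaugeTransform g u) = φ u) → (∀ u, φ u ≠ 0 → u ∈ K.𝒰 β) →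
            tubeForm β (boFunAd L φ (K.Ω β)) ≤ K.σ β * K.γ β * (1 + K.κ β) * qform su2Rep ((L : ℝ) ^ 3 * β) (fun u => φ u * K.W β u) (fun u => φ u * K.W β u) +
              K.κ β * K.σ β * K.γ β * levelValue su2Rep 1 ((L : ℝ) ^ 3 * β) 0 * l2 φ φ :=
          fun φ h1 h2 h3 h4 => by have := (abs_le.mp (hT φ h1 h2 h3 h4)).2; linarith only [this]
        have hOSB : ∀ G : Fin (k + 1) → (GaugeConfig 3 1 SU2 → ℝ), (∀ i, Measurable (G i)) → (∀ i, ∃ C : ℝ, ∀ U, |G i U| ≤ C) →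
            (∀ i (g : Site 3 1 → SU2) (U : GaugeConfig 3 1 SU2), G i (gaugeTransform g U) = G i U) → (∀ i U, G i U ≠ 0 → orbitDist U < K.δ₁ β) →
            (∀ a : Fin (k + 1) → ℝ, a ≠ 0 → 0 < l2 (fun U => (∑ i, a i * G i U) * K.W β U) (fun U => (∑ i, a i * G i U) * K.W β U)) →
              ∃ a : Fin (k + 1) → ℝ, a ≠ 0 ∧
                qform su2Rep ((L : ℝ) ^ 3 * β) (fun U => (∑ i, a i * G i U) * K.W β U) (fun U => (∑ i, a i * G i U) * K.W β U) * levelValue su2Rep 1 ((L : ℝ) ^ 3 * β) 0 ≤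
                  Real.exp (C * lam / 8 * bareLambda ((L : ℝ) ^ 3 * β)) * levelValue su2Rep 1 ((L : ℝ) ^ 3 * β) k * levelValue su2Rep 1 ((L : ℝ) ^ 3 * β) 0 *
                    l2 (fun U => ∑ i, a i * G i U) (fun U => ∑ i, a i * G i U) := by
          intro G h1 h2 h3 h4 h5
          obtain ⟨a, ha, h⟩ := hDS G h1 h2 h3 h4 h5
          refine ⟨a, ha, h.trans ?_⟩
          rw [← hBdef, ← hlamdef, ← hμ0def, ← hμkdef]
          refine mul_le_mul_of_nonneg_right (mul_le_mul_of_nonneg_right (mul_le_mul_of_nonneg_right (Real.exp_le_exp.mpr ?_) hμkpos.le) hμ0.le)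
            (l2_self_nonneg_lat _)
          have h6 : COS * lam ^ 2 ≤ |COS| * lam ^ 2 := mul_le_mul_of_nonneg_right (le_abs_self _) (sq_nonneg lam)
          have h7 : |COS| * lam ^ 2 ≤ C / 8 * lam ^ 2 := mul_le_mul_of_nonneg_right (by linarith only [hCOS]) (sq_nonneg lam)
          nlinarith only [h6, h7]
        have harith : (1 + K.κ β) * Real.exp (C * lam / 8 * lam) * μk + K.κ β * μ0 ≤ (1 - K.κ β) * Real.exp (C * lam / 4 * lam) * μk := by
          have h := arith_slow hy0 hy1 hκ0 hκy hμ0.le hμk2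
          have e1 : C * lam / 8 * lam = y / 8 := by rw [hydef]; ring
          have e2 : C * lam / 4 * lam = y / 4 := by rw [hydef]; ring
          rw [e1, e2]; exact h
        obtain ⟨CW, hCW⟩ := K.hWb β
        obtain ⟨a, ha, hslow⟩ := slow_rate_clause_of_dressed (K.hwm β) hCw (K.hw0 β) (K.hwinv β) (K.hΩm β) (K.hΩ1 β) (K.hΩinv β)
          (K.hWm β) hCW (K.h𝒰m β) (K.h𝒰inv β)
          (K.h𝒰δ₁ β) (K.hσ β).le (K.hγ β) hκ0 hκ1 hN hTup hOSB hμ0 hμkpos.le harith hfm (fun i => ⟨Cf i, hCf i⟩)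
        refine ⟨a, ha, ?_⟩
        have e : C * lam / 4 * lam = C * lam ^ 2 / 4 := by ring
        rw [e] at hslow
        exact hslow
  obtain ⟨β₀, hβ₀⟩ := Filter.eventually_atTop.mp hev
  exact ⟨β₀, fun β hβ => hβ₀ β hβ⟩

/-! ## §2 ★★★★ The two cruxes from DRESSED rate bricks for the record weight (`K = 43`) -/

/-- ★★★★ **K1 `NearFlatRatioLaw` ⇐ dressed rate bricks** for the record weight `recordChi L (1/40) 43 M` (`M ≥ 2`), test support `{orbitDist < β^{−1/40}}`, on every `L ≥ 2`:
package from the bricks, one-orbit inner RATE at `k = 1` (`innerRateAt_of_ratePackage`), then `nearFlatRatioLaw_of_innerRate`. [cite: Luscher1983, §3] -/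
theorem nearFlatRatioLaw_of_rateBricksD (M : ℝ) (hM : 2 ≤ M)
    (K : ∀ (L : ℕ) [NeZero L], 2 ≤ L → BORateBricksD L (recordChi L (1 / 40) 43 M) (powScale (1 / 40))) :
    Summit.QuantumFields.YangMills.Theses.FlatTubeReduction.NearFlatRatioLaw :=
  Summit.QuantumFields.YangMills.Theorems.FlatTubeReduction.nearFlatRatioLaw_of_innerRate fun L _ hL =>
    innerRateAt_of_ratePackage (L := L) 1 (fun β => powScale_pos (1 / 40) β) powScale_fortieth_eventually_le
      (softTubeAdmissible_recordChi' (1 / 40) 43 M (by norm_num) hM) (softTubeBORatePackageOn_of_rateBricksD (K L hL))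

/-- ★★★★ **FCL 23943 `FemtoGapFixedLattice` ⇐ dressed rate bricks**, likewise (`L = 1` is crux ONE). [cite: Luscher1983, §3] -/
theorem femtoGapFixedLattice_of_rateBricksD (M : ℝ) (hM : 2 ≤ M)
    (K : ∀ (L : ℕ) [NeZero L], 2 ≤ L → BORateBricksD L (recordChi L (1 / 40) 43 M) (powScale (1 / 40))) :
    FemtoGapFixedLattice := by
  intro L _
  by_cases hL : 2 ≤ L
  · exact femtoGapFixedLatticeAt_of_valley_innerRate (L := L) (p := 1 / 40) (q := 17 / 20) (by norm_num) (by norm_num) (by norm_num)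
      (valleyGainAt_ledger hL)
      (innerRateAt_of_ratePackage (L := L) 1 (fun β => powScale_pos (1 / 40) β) powScale_fortieth_eventually_le
        (softTubeAdmissible_recordChi' (1 / 40) 43 M (by norm_num) hM) (softTubeBORatePackageOn_of_rateBricksD (K L hL)))
  · have hL1 : L = 1 := by
      have h0 : L ≠ 0 := NeZero.ne L
      omega
    subst hL1
    exact femtoGapOneSite_proof

end Summit.QuantumFields.YangMills.Theorems.FemtoTransferGap.RateTube

end
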